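import Literature.Analysis.FunctionSpaces.TorusAnalyticComposition
import HarnessLib

/-!
# Bookkeeping for the Armstrong–Vicol analyticity seminorms `⟦·⟧_{n,R}`: coordinates, the derivative shift,
# radius change at order `≥ 1`, constants

Analysis/FunctionSpaces proof file (theorems only; no definitions, no named facts). Elementary algebra of the seminorms
`⟦f⟧_{n,R} = (n+1)²/(n! Rⁿ) sup_{|l|=n} ‖∂^l f‖_∞` (`Torus.dnorm`, Armstrong–Vicol App. A (A.1)) used by the analytic tower
of the Lagrangian carriers of cell `ad-ideate` (K1L_D `stmt-AnomalousDissipation-27980`) to pass between the shapes in which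
App. A Prop. 7.6 (composition), Lemma 7.1 (products) and Prop. 7.11 (flow gradients) are stated in the tree:

* `dnorm_le_sum_coord` — the vector seminorm is dominated by the sum of the coordinate seminorms (`‖v‖₂ ≤ ‖v‖₁`);
* `dnorm_const_eq_zero`, `dnorm_const_add` — constants are invisible at order `n ≥ 1`;
* `dnorm_zero_le_iff` — order zero is the sup norm;
* `dnorm_radius_le_of_one_le` — at order `n ≥ 1`, enlarging the radius `R ≤ R'` GAINS the factor `R/R'`;
* `dnorm_succ_le_of_partialDeriv` — THE DERIVATIVE SHIFT: `⟦f⟧_{n+1,R} ≤ (9/8) M/R` if `⟦∂ⱼ f⟧_{n,R} ≤ M` for all `j`, `n ≥ 1`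
  (the factor `(n+2)²/(n+1)³ ≤ 9/8`).

## References

* S. Armstrong, V. Vicol, *Anomalous diffusion by fractal homogenization*, Ann. PDE 11 (2025), arXiv:2305.05048,
  App. A (A.1) (the seminorms). [`ArmstrongVicol2025`]
* S. G. Krantz, H. R. Parks, *A primer of real analytic functions*, 2nd ed. (Birkhäuser 2002), §2.2. [`KrantzParks2002`]
-/

noncomputable section

open Set Function Finset

namespace Literature.Analysis.FunctionSpaces

namespace Torus

variable {d : Type*} [Fintype d] [DecidableEq d]
variable {F : Type*} [NormedAddCommGroup F] [NormedSpace ℝ F]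

/-! ## §1 Coordinates -/

omit [DecidableEq d] in
/-- `‖v‖ ≤ Σᵢ |vᵢ|` in `ℝ^d` (private copy of `Torus.norm_le_sum_abs_coord` of `TorusMollifiedGradNorm`, whose import cone is the
mollifier chain). [folklore] -/
private theorem norm_le_sum_abs_coord₁ (v : EuclideanSpace ℝ d) : ‖v‖ ≤ ∑ i, |v i| := by
  classical
  conv_lhs => rw [← (EuclideanSpace.basisFun d ℝ).sum_repr v]
  refine (norm_sum_le _ _).trans (Finset.sum_le_sum fun i _ => ?_)
  rw [EuclideanSpace.basisFun_repr, norm_smul, Real.norm_eq_abs, EuclideanSpace.basisFun_apply,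
    PiLp.norm_single, norm_one, mul_one]

/-- **The vector seminorm is dominated by the coordinate seminorms**: `⟦u⟧_{n,R} ≤ Σᵢ ⟦uᵢ⟧_{n,R}` (`R ≥ 0`, smooth `u`).
[cite: ArmstrongVicol2025, App. A (A.1)] -/
theorem dnorm_le_sum_coord (n : ℕ) {R : ℝ} (hR : 0 ≤ R) {u : UnitAddTorus d → EuclideanSpace ℝ d} (hu : IsSmooth u) :
    dnorm n R u ≤ ∑ i, dnorm n R (fun y => u y i) := by
  have hD : derivSup n u ≤ ∑ i, derivSup n (fun y => u y i) := by
    refine derivSup_le (Finset.sum_nonneg fun i _ => derivSup_nonneg _ _) fun l hl y => ?_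
    refine (norm_le_sum_abs_coord₁ _).trans (Finset.sum_le_sum fun i _ => ?_)
    rw [← Real.norm_eq_abs, ← congrFun (iterPartialDeriv_apply_coord hu i l) y]
    exact hl ▸ norm_iterPartialDeriv_le_derivSup (hu.apply i) l y
  rw [dnorm_def]
  calc ((n : ℝ) + 1) ^ 2 / ((Nat.factorial n : ℝ) * R ^ n) * derivSup n u
      ≤ ((n : ℝ) + 1) ^ 2 / ((Nat.factorial n : ℝ) * R ^ n) * ∑ i, derivSup n (fun y => u y i) :=
        mul_le_mul_of_nonneg_left hD (div_nonneg (sq_nonneg _) (mul_nonneg (Nat.cast_nonneg _) (pow_nonneg hR _)))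
    _ = ∑ i, dnorm n R (fun y => u y i) := by rw [Finset.mul_sum]; rfl

/-! ## §2 Constants and order zero -/

omit [Fintype d] in
/-- Constants have zero seminorm at every order `n ≥ 1`. [cite: ArmstrongVicol2025, App. A (A.1)] -/
theorem dnorm_const_eq_zero {n : ℕ} (hn : 1 ≤ n) (R : ℝ) (c : F) : dnorm n R (fun _ : UnitAddTorus d => c) = 0 := by
  have hD : derivSup n (fun _ : UnitAddTorus d => c) = 0 := by
    refine le_antisymm (derivSup_le le_rfl fun l hl y => ?_) (derivSup_nonneg _ _)
    have hl0 : l ≠ [] := by rintro rfl; simp at hl; omega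
    rw [iterPartialDeriv_const c l hl0]; simp
  rw [dnorm_def, hD, mul_zero]

/-- Adding a constant does not change the seminorms of order `n ≥ 1`. [cite: ArmstrongVicol2025, App. A (A.1)] -/
theorem dnorm_const_add {n : ℕ} (hn : 1 ≤ n) {R : ℝ} (hR : 0 < R) (c : F) {g : UnitAddTorus d → F} (hg : IsSmooth g) :
    dnorm n R (fun y => c + g y) = dnorm n R g := by
  refine le_antisymm ?_ ?_
  · have h := dnorm_add_le n hR (isSmooth_const c) hg
    rw [dnorm_const_eq_zero hn R c, zero_add] at h
    exact h
  · have hcg : IsSmooth (fun y => c + g y) := (isSmooth_const c).add hg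
    have h := dnorm_add_le n hR hcg (isSmooth_const (-c))
    rw [dnorm_const_eq_zero hn R (-c), add_zero] at h
    have e : (fun y => (c + g y) + -c) = g := by funext y; abel
    rw [e] at h
    exact h

omit [Fintype d] in
/-- **Order zero is the sup norm**: `⟦f⟧_{0,R} ≤ C` iff `‖f‖ ≤ C` pointwise (smooth `f`). [cite: ArmstrongVicol2025, App. A (A.1)] -/
theorem dnorm_zero_le_of_forall_norm_le {R C : ℝ} (hR : 0 < R) {f : UnitAddTorus d → F} (hC : 0 ≤ C)
    (h : ∀ y, ‖f y‖ ≤ C) : dnorm 0 R f ≤ C :=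
  dnorm_le_of_forall_norm_iterPartialDeriv_le hR hC fun l hl y => by
    obtain rfl : l = [] := List.eq_nil_of_length_eq_zero hl
    simpa using h y

/-- Read-out at order zero: `‖f y‖ ≤ ⟦f⟧_{0,R}`. [cite: ArmstrongVicol2025, App. A (A.1)] -/
theorem norm_le_dnorm_zero {R : ℝ} {f : UnitAddTorus d → F} (hf : IsSmooth f) (y : UnitAddTorus d) :
    ‖f y‖ ≤ dnorm 0 R f := by
  rw [dnorm_def]; simpa using norm_le_derivSup_zero hf y

/-! ## §3 Radius change at order `≥ 1` and the derivative shift -/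

/-- **Enlarging the radius gains a factor at order `n ≥ 1`**: `⟦f⟧_{n,R'} ≤ (R/R') ⟦f⟧_{n,R}` for `0 < R ≤ R'`.
[cite: ArmstrongVicol2025, App. A (A.1)] -/
theorem dnorm_radius_le_of_one_le {n : ℕ} (hn : 1 ≤ n) {R R' : ℝ} (hR : 0 < R) (hRR' : R ≤ R') (f : UnitAddTorus d → F) :
    dnorm n R' f ≤ R / R' * dnorm n R f := by
  have hR' : 0 < R' := hR.trans_le hRR'
  rw [dnorm_radius_scale n hR hR']
  refine mul_le_mul_of_nonneg_right ?_ (dnorm_nonneg n hR.le f)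
  have h1 : R / R' ≤ 1 := (div_le_one hR').2 hRR'
  calc (R / R') ^ n ≤ (R / R') ^ 1 := pow_le_pow_of_le_one (by positivity) h1 hn
    _ = R / R' := pow_one _

/-- **The derivative shift**: if `⟦∂ⱼ f⟧_{n,R} ≤ M` for every direction `j` (`n ≥ 1`, `R > 0`, `M ≥ 0`), then
`⟦f⟧_{n+1,R} ≤ (9/8) · M / R` (every word of length `n+1` is `l ++ [j]`; `(n+2)²/(n+1)³ ≤ 9/8`).
[cite: ArmstrongVicol2025, App. A (A.1)] -/
theorem dnorm_succ_le_of_partialDeriv {n : ℕ} (hn : 1 ≤ n) {R M : ℝ} (hR : 0 < R) (hM : 0 ≤ M) {f : UnitAddTorus d → F}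
    (hf : IsSmooth f) (h : ∀ j : d, dnorm n R (partialDeriv j f) ≤ M) :
    dnorm (n + 1) R f ≤ 9 / 8 * M / R := by
  refine dnorm_le_of_forall_norm_iterPartialDeriv_le hR (by positivity) fun l hl y => ?_
  obtain ⟨l', j, rfl, hl'⟩ := List.exists_eq_concat_of_length_eq_succ hl
  rw [iterPartialDeriv_concat]
  have h1 := norm_iterPartialDeriv_le_of_dnorm_le (hf.partialDeriv j) hR (h j) hl' y
  refine h1.trans ?_
  -- `M n! Rⁿ/(n+1)² ≤ (9/8)(M/R) (n+1)! R^{n+1}/(n+2)²`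
  rw [Nat.factorial_succ, Nat.cast_mul, pow_succ]
  push_cast
  have hfac : (0 : ℝ) < (Nat.factorial n : ℝ) := by exact_mod_cast Nat.factorial_pos n
  have hn1 : (1 : ℝ) ≤ n := by exact_mod_cast hn
  rw [div_le_div_iff₀ (by positivity) (by positivity)]
  -- clear denominators by hand
  have key : ((n : ℝ) + 1 + 1) ^ 2 ≤ 9 / 8 * ((n : ℝ) + 1) ^ 3 := by nlinarith [hn1, sq_nonneg ((n : ℝ) - 1)]
  have hpos : 0 ≤ M * ((Nat.factorial n : ℝ) * R ^ n) := by positivity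
  calc M * ((Nat.factorial n : ℝ) * R ^ n) * ((n : ℝ) + 1 + 1) ^ 2
      ≤ M * ((Nat.factorial n : ℝ) * R ^ n) * (9 / 8 * ((n : ℝ) + 1) ^ 3) := mul_le_mul_of_nonneg_left key hpos
    _ = 9 / 8 * M / R * (((n : ℝ) + 1) * (Nat.factorial n : ℝ) * (R ^ n * R)) * ((n : ℝ) + 1) ^ 2 := by
        field_simp

/-- The derivative shift for a scalar function whose partial derivatives are known up to a constant:
if `⟦cⱼ + ∂ⱼ f⟧_{n,R} ≤ M` for all `j` (`n ≥ 1`) then `⟦f⟧_{n+1,R} ≤ (9/8) M/R`. [cite: ArmstrongVicol2025, App. A (A.1)] -/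
theorem dnorm_succ_le_of_const_add_partialDeriv {n : ℕ} (hn : 1 ≤ n) {R M : ℝ} (hR : 0 < R) (hM : 0 ≤ M)
    {f : UnitAddTorus d → F} (hf : IsSmooth f) (c : d → F) (h : ∀ j : d, dnorm n R (fun y => c j + partialDeriv j f y) ≤ M) :
    dnorm (n + 1) R f ≤ 9 / 8 * M / R :=
  dnorm_succ_le_of_partialDeriv hn hR hM hf fun j => by
    rw [← dnorm_const_add hn hR (c j) (hf.partialDeriv j)]; exact h j

end Torus

end Literature.Analysis.FunctionSpaces

end
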